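import Summits.QuantumFields.YangMills.Theorems.BalabanUVNodesN09NestingOfHierAxial
import Summits.QuantumFields.YangMills.Theorems.BalabanUVNodesN09AtRecord13SepCoPHAxOnDomains

/-!
# NODE N09 ([Balaban1987RG1] Thm 3 p.264) AT THE RE-CENTRED («Ax») STAGE-13 RECORD — THE NESTING ROW SUPPLIED AND THE Ax DOOR v2: the Ax twins of dag-n09-w3's `…FluctNesting`
# §1–§2, dag-n09-w1 g2's `…HeredModFineOfThm1` §2–§4 and `…NestingOfHierAxial` §2, over def-Y's re-centred cut-off `chiβOfRecord₁₃Ax` ∕ block-axial critical configuration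
# `critCfgAxOfRecord`; composed with this seat's on-domains Ax door v1 (✓p811884) into ★ the Ax door v2 — rows `hreg8 ∕ hle ∕ hεreg ∕ haxbg ∕ hχregpt ∕ hint ∕ h11 ∕ hres ∕ huniq` +
# [B7]-numerics; NO `haxDom` (the re-centred critical configuration is block-axial BY CONSTRUCTION), NO (M1-dom) (a theorem at the re-centred record), NO `h11reg` (FILE 2's radius transfer)

TRACK A (YM-PLAN §2d), seat `pub-ymgap-dag-n24-c` (gen 23; K1ᴬ engine-lane hand typing the one K1ᴬ child without an Ax home, dag-lead WORDS 639 «by need; yields to any dag-n09 seat»;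
helper lane `--supports stmt-QuantumFields-27239`, count-neutral).  [I] = [Balaban1987RG1]; [B11] = [Balaban1985Variational]; [B7] = [Balaban1985Averaging].

WHY.  ✓p811884 (`…N09AtRecord13SepCoPHAxOnDomains`) typed N09's Theorem-3 member at the re-centred record with the NESTING row `hnestreg` («`Ū^{i+1}(U_k V) ∈ regSetOfRecord K i ρ_i ∩
domAlt_{i+1}`») and [B11] Thm 1 at the cut-off radius (`h11reg`) DISPLAYED.  At the centred record dag-n09-w1 g2 derived `hnestreg` from the pointwise (F7a) `hχregpt`, [B11] ×3 at `εbg`,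
the (8)-membership clause `hreg8`, `0 ≤ εreg ≤ εbg`, the [B7]-numerics and TWO axiality conventions: `haxbg` (the partial averages `Ū^j(U_k V)` of the record's background are block-axial)
and `haxDom` (the record's CHOSEN critical configuration is block-axial on the domains).  The mechanism ((N29) «χ_j(Ū^j(U_k V)) = 1» ⇐ HERED «`V^{(j)}(Ū^{j+1}(U_k V)) = Ū^j(U_k V)`» ⇐ HERED
modulo a FINE gauge transformation (a theorem of [B11] Thm 1 alone) + «two block-axial configurations in one fine orbit are equal») transfers to the re-centred record token for token, and
there `haxDom` DISAPPEARS: def-Y's `critCfgAxOfRecord ν K j W := axialize (contourOfRecord F N K j) (critCfgOfRecord …)` is block-axial for the record's contour datum by construction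
(`axialGauge_critCfgAxOfRecord`), and the axialiser is itself fine (`axializer_emb`), so HERED-mod-fine survives the re-centring (§2).  Hence at the re-centred record the nesting row costs
exactly ONE convention — `haxbg` for the record's contour data `contourOfRecord F N P.K j` (the background of record `Uk` is a bare choice; a hierarchically axial selection makes it
definitional, def-R∕def-T's re-point; NOTE the centred door let its consumer choose the contour system `cd` for BOTH axiality rows, here `haxbg` is PINNED to `contourOfRecord`, the datum
`critCfgAxOfRecord` is axialised for — the centred row SPECIALISED, not weakened) — and the door's [B11]-at-`εreg` row is FILE 2's `thm1Package_εreg_of_εbg_of_reg8` (dag-n09-w1).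
THIS FILE: §1 (FluctNesting-Ax) «at the block-axial background the re-centred fluctuation field vanishes»: `chiFix29AxOfRecord_eq_one_of_critCfgAx_eq`, (N29)ᴬˣ at one field ∕ along a run from
HEREDᴬˣ, (F7b)ᴬˣ from (F7a)ᴬˣ + (N29)ᴬˣ (pure logic); §2 (HeredModFine-Ax) HEREDᴬˣ modulo a fine transformation from [B11] ×3 at `εbg` + `hreg8` + `0 ≤ εreg ≤ εbg` (dag-n09-w1 g2's §2 composed
with the fine axialiser), HEREDᴬˣ exactly from `haxbg` ALONE (his §3 with `haxcrit` supplied by `axialGauge_critCfgAxOfRecord`); §3 (NestingOfHierAxial-Ax) the a.e. (F7a-dom)ᴬˣ from its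
pointwise form and ★★ `hnestregAx_of_suppPt_of_hierAxial_of_reg8` (regular-set half by §1–§2, small-field half = his χ-free `iterUk_mem_domAlt_of_ukExists`, [B7] Prop. 2 (53) + numerics, BY
NAME); §4 ★★★ THE Ax DOOR v2 `thm3Member_forall_stage13SepCoPHAx_onDomains_of_hierAxial_of_reg8_of_suppPt` = ✓p811884 §3 fed by §3 and FILE 2 — displayed: `hreg8`, `hle`, `hεreg`, `haxbg`
(w.r.t. `contourOfRecord`), `hχregpt`, `hint`, `h11 ∕ hres ∕ huniq` at `θ.εbg`, `0 < θ.ε₂₉`, `0 < θ.εbg`, `C₀(d)·θ.εbg ≤ ⅓`, `2θ.εbg ≤ 2δ_N∕((d+4)L)²`, `2θ.εbg ≤ θ.ν.ε₀·L²` — the centred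
door v1.2's list MINUS `haxDom` and MINUS the contour data for the critical configuration; §5 the Ax engine's `h09T` shape from the same rows.

HONEST FRAMING.  Count-neutral kernel gauge ∕ order bookkeeping over NODE 00's re-centred definitions, composed BY NAME with dag-n09-w1∕w3∕w4's χ-free theorems; NOTHING of Bałaban's
asserted ([B11] Thm 1's clauses, (F7a), (I19), the hierarchical axiality of the record's background and the [B7]-numerics are DISPLAYED hypotheses, located in print); NO carrier re-pointed;
N09 NOT discharged; K0ᴬ ∕ K1ᴬ OPEN; one finite 𝕋⁴ programme at fixed `ε = L^{−K}` — R4 is the conditional rung `BalabanLadder.UV` only; NOT continuum ∕ ℝ⁴ ∕ OS ∕ mass gap ∕ Clay.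
THEOREMS ONLY (0 `def`, 0 `sorry`), standard axioms.
-/

noncomputable section

namespace Summit.QuantumFields.YangMills.BalabanUVNodes.N09NestingOfHierAxialAtRecordAx

open MeasureTheory
open Literature.MathematicalPhysics.QuantumFieldTheory.Balaban1983to89
open Literature.MathematicalPhysics.QuantumFieldTheory.Balaban1983to89.T4Continuum (T4Family)
open Literature.MathematicalPhysics.QuantumFieldTheory.Balaban1983to89.DagBinding (WorldP leavesP)
open Literature.MathematicalPhysics.QuantumFieldTheory.Balaban1983to89.Node00
open Literature.MathematicalPhysics.QuantumFieldTheory.Balaban1983to89.ExpMeanLog (deltaSU)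
open Literature.MathematicalPhysics.QuantumFieldTheory.Balaban1983to89.GaugeField (gaugeAct)
open Literature.MathematicalPhysics.QuantumFieldTheory.Balaban1983to89.B16Sect1Backgrounds (mulG gaugeAct_gaugeAct)
open Literature.MathematicalPhysics.QuantumFieldTheory.Balaban1983to89.BlockAxialRepresentative (axialize_def axializer_emb)
open Summit.QuantumFields.YangMills.BalabanUVNodes.N09BackgroundRadiiTransferRestrict (succ_le_range_of_le_of_lt thm1Package_εreg_of_εbg_of_reg8)
open Summit.QuantumFields.YangMills.BalabanUVNodes.N09AxialCovariance181 (gaugeAct_eq_self_of_fine_of_axialGauge)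
open Summit.QuantumFields.YangMills.BalabanUVNodes.N09HeredModFineOfThm1 (hered_mod_fine_of_thm1_εbg_of_reg8)
open Summit.QuantumFields.YangMills.BalabanUVNodes.N09NestingOfHierAxial (iterUk_mem_domAlt_of_ukExists)
open Summit.QuantumFields.YangMills.BalabanUVNodes.N09AtRecord13SepCoPHAxOnDomains (thm3Member_forall_stage13SepCoPHAx_onDomains_of_thm1reg)

variable {F : T4Family} {N : ℕ} [NeZero N]

/-! ## §1. (FluctNesting-Ax) At the block-axial background the RE-CENTRED (2.9) fluctuation field vanishes; (N29)ᴬˣ; (F7b)ᴬˣ from (F7a)ᴬˣ -/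

/-- **«AT THE BACKGROUND THE FLUCTUATION FIELD VANISHES», re-centred form**: `V^{(j)}_{ax}(V̄) = V` and `0 < ε₁` give `χ^{(2.9)}_{j,ax}(V) = 1` (dag-n09-w3's `chiFix29OfRecord_eq_one_of_critCfg_eq`
with `critCfgOfRecord ↦ critCfgAxOfRecord`). [cite: Balaban1987RG1, (2.1)–(2.3) p.265 and (2.9) p.266] -/
theorem chiFix29AxOfRecord_eq_one_of_critCfgAx_eq (ν : Stage7Numerics) {ε₁ : ℝ} (hε : 0 < ε₁) (K j : ℕ) {V : GaugeField (F.P K) j (SU N)}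
    (h : critCfgAxOfRecord F N ν K j ((avOfRecord F N K j).avg V) = V) : chiFix29AxOfRecord F N ν ε₁ K j V = 1 := by
  rw [chiFix29AxOfRecord_eq_one_iff]
  intro b _
  rw [fluctDevAxOfRecord_apply, h, inv_mul_cancel, GaugeGroup.dist1_one]
  exact hε

/-- **(N29)ᴬˣ AT ONE FIELD** for the re-centred β-slot cut-off `chiβOfRecord₁₃Ax θ₀ = chiFixed29Ax θ₀.ν θ₀.ε₂₉` (coupling-blind): if `V^{(j)}_{ax}(M^{j+1}(U₀)) = M^j(U₀)` and `0 < ε₂₉` then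
`χ^{Ax}_j(M^j(U₀)) = 1`. [cite: Balaban1987RG1, (2.3) p.265 and (2.9) p.266] -/
theorem chiβ13Ax_iter_eq_one_of_critCfgAx_eq (θ₀ : Stage13Params F N) (hε : 0 < θ₀.ε₂₉) (K : ℕ) (g : ℕ → ℝ) (j : ℕ)
    {U₀ : GaugeField (F.P K) 0 (SU N)}
    (h : critCfgAxOfRecord F N θ₀.ν K j (Averaging.iter (avOfRecord F N K) (j + 1) U₀) = Averaging.iter (avOfRecord F N K) j U₀) :
    chiβOfRecord₁₃Ax F N θ₀ K g j (Averaging.iter (avOfRecord F N K) j U₀) = 1 := by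
  have h' : critCfgAxOfRecord F N θ₀.ν K j ((avOfRecord F N K j).avg (Averaging.iter (avOfRecord F N K) j U₀)) =
      Averaging.iter (avOfRecord F N K) j U₀ := h
  rw [chiβOfRecord₁₃Ax_apply]
  exact chiFix29AxOfRecord_eq_one_of_critCfgAx_eq θ₀.ν hε K j h'

/-- **(N29)ᴬˣ ALONG A RUN FROM HEREDᴬˣ**: if for every `V ∈ dom k` (`k ≤ K`) and `j < k` the re-centred critical configuration over `Ū^{j+1}(U_k V)` IS `Ū^j(U_k V)`, and `0 < ε₂₉`, then
`χ^{Ax}_j(Ū^j(U_k V)) = 1`. [cite: Balaban1987RG1, (2.3) p.265, (2.9) p.266 and (1.1)–(1.2) p.260; Balaban1985Variational, Thm 1 (9)–(10) p.279] -/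
theorem chiβ13Ax_iterUk_eq_one_of_critCfgAx_hered (θ₀ : Stage13Params F N) (hε : 0 < θ₀.ε₂₉) (P : B12.RunParams) {ε : ℝ}
    {dom : (k : ℕ) → Set (GaugeField (F.P P.K) k (SU N))}
    (hher : ∀ k, k ≤ P.K → ∀ V ∈ dom k, ∀ j < k,
      critCfgAxOfRecord F N θ₀.ν P.K j (Averaging.iter (avOfRecord F N P.K) (j + 1) (Uk F N P.K k ε V)) =
        Averaging.iter (avOfRecord F N P.K) j (Uk F N P.K k ε V)) :
    ∀ k, k ≤ P.K → ∀ V ∈ dom k, ∀ j < k,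
      chiβOfRecord₁₃Ax F N θ₀ P.K (gOfRecord₁₃Ax F N θ₀ P) j (Averaging.iter (avOfRecord F N P.K) j (Uk F N P.K k ε V)) = 1 :=
  fun k hk V hV j hj => chiβ13Ax_iter_eq_one_of_critCfgAx_eq θ₀ hε P.K _ j (hher k hk V hV j hj)

/-- **(F7b)ᴬˣ FROM (F7a)ᴬˣ AND (N29)ᴬˣ** (pure logic, `1 ≠ 0`; dag-n09-w3's `iterUk_mem_regSet_of_supp_of_chiβ13_eq_one` with the re-centred cut-off).
[cite: Balaban1987RG1, p.256 l.6, (2.1) p.265, (2.9)–(2.10) pp.266–267 and p.259 (bookkeeping)] -/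
theorem iterUk_mem_regSet_of_supp_of_chiβ13Ax_eq_one (θ₀ : Stage13Params F N) (P : B12.RunParams) {ε : ℝ}
    {dom : (k : ℕ) → Set (GaugeField (F.P P.K) k (SU N))}
    (hχreg : ∀ i, i + 1 < P.K → ∀ U, U ∉ regSetOfRecord F N P.K i
        (betaInputOfRecord F N (TβOfRecord₁₃ F N) (chiβOfRecord₁₃Ax F N θ₀) P.K (gOfRecord₁₃Ax F N θ₀ P) i) →
      chiβOfRecord₁₃Ax F N θ₀ P.K (gOfRecord₁₃Ax F N θ₀ P) (i + 1) U = 0)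
    (hone : ∀ k, k ≤ P.K → ∀ V ∈ dom k, ∀ j < k,
      chiβOfRecord₁₃Ax F N θ₀ P.K (gOfRecord₁₃Ax F N θ₀ P) j (Averaging.iter (avOfRecord F N P.K) j (Uk F N P.K k ε V)) = 1) :
    ∀ k, k ≤ P.K → ∀ V ∈ dom k, ∀ i, i + 1 < k →
      Averaging.iter (avOfRecord F N P.K) (i + 1) (Uk F N P.K k ε V) ∈ regSetOfRecord F N P.K i
        (betaInputOfRecord F N (TβOfRecord₁₃ F N) (chiβOfRecord₁₃Ax F N θ₀) P.K (gOfRecord₁₃Ax F N θ₀ P) i) := by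
  intro k hk V hV i hi
  by_contra hmem
  have h0 := hχreg i (lt_of_lt_of_le hi hk) _ hmem
  have h1 := hone k hk V hV (i + 1) hi
  rw [h1] at h0
  exact one_ne_zero h0

/-! ## §2. (HeredModFine-Ax) HEREDᴬˣ modulo a fine transformation from [B11] Thm 1 alone; HEREDᴬˣ exactly from the hierarchical axiality of the background ALONE -/

/-- ★ **HEREDᴬˣ MODULO A FINE TRANSFORMATION**: for `V ∈ domAlt_k`, `j < k ≤ K`, the RE-CENTRED critical configuration over the background's `(j+1)`-average is the background's `j`-average
up to a level-`j` gauge transformation trivial at the block centres — dag-n09-w1 g2's fine `s` (from [B11] ×3 at `εbg`, `hreg8`, `0 ≤ εreg ≤ εbg`) composed with the axialiser, which is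
itself `1` at the block centres (`axializer_emb`). [cite: Balaban1987RG1, (2.3) p.265 and (1.1) p.260; Balaban1985Variational, Thm 1 (6) p.279; Balaban1985Averaging, (11) p.19] -/
theorem heredAx_mod_fine_of_thm1_εbg_of_reg8 (ν : Stage7Numerics) (εbg : ℝ) (K : ℕ)
    (hres : ∀ k, k ≤ K → HRestrict F N εbg K k (domAltOfRecord F N ν K k))
    (huniq : ∀ k, k ≤ K → ∀ V ∈ domAltOfRecord F N ν K k, ∀ j < k,
      UniqueUkOrbit F N K (j + 1) εbg (Averaging.iter (avOfRecord F N K) (j + 1) (Uk F N K k εbg V)))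
    (hreg8 : ∀ k, k ≤ K → ∀ V ∈ domAltOfRecord F N ν K k, Uk F N K k εbg V ∈ bgReg F N K k ν.εreg) (hle : ν.εreg ≤ εbg) (hεreg : 0 ≤ ν.εreg) :
    ∀ k, k ≤ K → ∀ V ∈ domAltOfRecord F N ν K k, ∀ j < k, ∃ s : GaugeTransf (F.P K) j (SU N), (∀ y : Site (F.P K) (j + 1), s (emb y) = 1) ∧
      critCfgAxOfRecord F N ν K j (Averaging.iter (avOfRecord F N K) (j + 1) (Uk F N K k εbg V)) =
        gaugeAct s (Averaging.iter (avOfRecord F N K) j (Uk F N K k εbg V)) := by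
  intro k hk V hV j hj
  obtain ⟨s, hs, hEq⟩ := hered_mod_fine_of_thm1_εbg_of_reg8 ν εbg K hres huniq hreg8 hle hεreg k hk V hV j hj
  have hj' : j + 1 ≤ (F.P K).m + (F.P K).K := succ_le_range_of_le_of_lt (F := F) hk hj
  refine ⟨mulG (BlockAxialRepresentative.axializer (contourOfRecord F N K j)
      (critCfgOfRecord F N ν K j (Averaging.iter (avOfRecord F N K) (j + 1) (Uk F N K k εbg V)))) s, fun y => ?_, ?_⟩
  · show _ * _ = (1 : SU N)
    rw [axializer_emb hj', hs y, one_mul]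
  · rw [critCfgAxOfRecord_def, axialize_def, hEq, gaugeAct_gaugeAct, ← hEq]

/-- ★★ **HEREDᴬˣ EXACTLY FROM THE HIERARCHICAL AXIALITY OF THE BACKGROUND ALONE**: if the background's `j`-average `Ū^j(U_k V)` is block-axial for the record's contour datum
`contourOfRecord F N K j`, then `V^{(j)}_{ax}(Ū^{j+1}(U_k V)) = Ū^j(U_k V)` — the fine `s` above relates two block-axial configurations (the re-centred one is axial BY CONSTRUCTION,
`axialGauge_critCfgAxOfRecord`), so it is `1` (n09-w2 g2's `gaugeAct_eq_self_of_fine_of_axialGauge`).  NO `haxDom` ∕ `haxcrit` row. [cite: Balaban1987RG1, (2.2)–(2.3) p.265; Balaban1985RegularSpaces, (1.15) p.78; Balaban1985Variational, Thm 1 (6) p.279] -/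
theorem heredAx_of_hierAxial_of_thm1_εbg_of_reg8 (ν : Stage7Numerics) (εbg : ℝ) (K : ℕ)
    (hres : ∀ k, k ≤ K → HRestrict F N εbg K k (domAltOfRecord F N ν K k))
    (huniq : ∀ k, k ≤ K → ∀ V ∈ domAltOfRecord F N ν K k, ∀ j < k,
      UniqueUkOrbit F N K (j + 1) εbg (Averaging.iter (avOfRecord F N K) (j + 1) (Uk F N K k εbg V)))
    (hreg8 : ∀ k, k ≤ K → ∀ V ∈ domAltOfRecord F N ν K k, Uk F N K k εbg V ∈ bgReg F N K k ν.εreg) (hle : ν.εreg ≤ εbg) (hεreg : 0 ≤ ν.εreg)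
    (haxbg : ∀ k, k ≤ K → ∀ V ∈ domAltOfRecord F N ν K k, ∀ j < k,
      AxialGauge (contourOfRecord F N K j) (Averaging.iter (avOfRecord F N K) j (Uk F N K k εbg V))) :
    ∀ k, k ≤ K → ∀ V ∈ domAltOfRecord F N ν K k, ∀ j < k,
      critCfgAxOfRecord F N ν K j (Averaging.iter (avOfRecord F N K) (j + 1) (Uk F N K k εbg V)) = Averaging.iter (avOfRecord F N K) j (Uk F N K k εbg V) := by
  intro k hk V hV j hj
  obtain ⟨s, hs, hEq⟩ := heredAx_mod_fine_of_thm1_εbg_of_reg8 ν εbg K hres huniq hreg8 hle hεreg k hk V hV j hj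
  have haxcrit := axialGauge_critCfgAxOfRecord (ν := ν) (succ_le_range_of_le_of_lt (F := F) hk hj)
    (Averaging.iter (avOfRecord F N K) (j + 1) (Uk F N K k εbg V))
  rw [hEq] at haxcrit ⊢
  exact gaugeAct_eq_self_of_fine_of_axialGauge _ (haxbg k hk V hV j hj) hs haxcrit

/-! ## §3. (NestingOfHierAxial-Ax) The a.e. (F7a-dom)ᴬˣ from its pointwise form; ★★ the nesting row at the re-centred record, supplied -/

/-- The a.e. support binder (F7a-dom)ᴬˣ is the `ae_of_all` image of the pointwise-on-domains clause. [cite: Balaban1987RG1, p.256 l.6 and (2.1) p.265 (bookkeeping)] -/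
theorem hχregAx_ae_of_suppPt (θ₀ : Stage13Params F N) (P : B12.RunParams)
    (hχregpt : ∀ i, i + 1 < P.K → ∀ U : GaugeField (F.P P.K) (i + 1) (SU N),
      (avOfRecord F N P.K (i + 1)).avg U ∈ domAltOfRecord F N θ₀.ν P.K (i + 2) →
        U ∉ regSetOfRecord F N P.K i (betaInputOfRecord F N (TβOfRecord₁₃ F N) (chiβOfRecord₁₃Ax F N θ₀) P.K (gOfRecord₁₃Ax F N θ₀ P) i) ∩
            domAltOfRecord F N θ₀.ν P.K (i + 1) →
          chiβOfRecord₁₃Ax F N θ₀ P.K (gOfRecord₁₃Ax F N θ₀ P) (i + 1) U = 0) :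
    ∀ i, i + 1 < P.K → ∀ᵐ U ∂(fieldMeasure (F.P P.K) (i + 1) (SU N)),
      (avOfRecord F N P.K (i + 1)).avg U ∈ domAltOfRecord F N θ₀.ν P.K (i + 2) →
        U ∉ regSetOfRecord F N P.K i (betaInputOfRecord F N (TβOfRecord₁₃ F N) (chiβOfRecord₁₃Ax F N θ₀) P.K (gOfRecord₁₃Ax F N θ₀ P) i) ∩
            domAltOfRecord F N θ₀.ν P.K (i + 1) →
          chiβOfRecord₁₃Ax F N θ₀ P.K (gOfRecord₁₃Ax F N θ₀ P) (i + 1) U = 0 :=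
  fun i hi => Filter.Eventually.of_forall (hχregpt i hi)

/-- ★★ **THE NESTING ROW `hnestreg` OF THE Ax ON-DOMAINS DOOR, SUPPLIED**: for every run `P`, level `k ≤ P.K`, small field `V ∈ domAlt_k` and `i + 1 < k`,
`Ū^{i+1}(U_k V) ∈ regSetOfRecord P.K i ρ_i ∩ domAltOfRecord θ₀.ν P.K (i+1)` (`ρ_i` over the re-centred cut-off) — from the pointwise (F7a)ᴬˣ `hχregpt`, `0 < θ₀.ε₂₉`, [B11]'s
`h11`-existence ∕ `hres` ∕ `huniq` at `εbg`, `hreg8`, `0 ≤ θ₀.ν.εreg ≤ εbg`, the hierarchical axiality `haxbg` of the background for the record's contour data, and the [B7]-numerics.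
Mechanism as dag-n09-w1 g2's: (N29)ᴬˣ at a point whose next average is a small field (his χ-free `iterUk_mem_domAlt_of_ukExists`, or `V` itself), so (F7a)ᴬˣ cannot fire there.  NO `haxDom`.
[cite: Balaban1987RG1, (2.1)–(2.3) p.265, (2.9)–(2.10) pp.266–267, (1.2) p.260, p.256 l.6; Balaban1985Averaging, Prop. 2 (53) p.26; Balaban1985Variational, Thm 1 (6) and (8) p.279] -/
theorem hnestregAx_of_suppPt_of_hierAxial_of_reg8 (θ₀ : Stage13Params F N) (hεχ : 0 < θ₀.ε₂₉) (P : B12.RunParams) {εbg : ℝ}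
    (hχregpt : ∀ i, i + 1 < P.K → ∀ U : GaugeField (F.P P.K) (i + 1) (SU N),
      (avOfRecord F N P.K (i + 1)).avg U ∈ domAltOfRecord F N θ₀.ν P.K (i + 2) →
        U ∉ regSetOfRecord F N P.K i (betaInputOfRecord F N (TβOfRecord₁₃ F N) (chiβOfRecord₁₃Ax F N θ₀) P.K (gOfRecord₁₃Ax F N θ₀ P) i) ∩
            domAltOfRecord F N θ₀.ν P.K (i + 1) →
          chiβOfRecord₁₃Ax F N θ₀ P.K (gOfRecord₁₃Ax F N θ₀ P) (i + 1) U = 0)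
    (hex : ∀ k, k ≤ P.K → ∀ V ∈ domAltOfRecord F N θ₀.ν P.K k, UkExists F N P.K k εbg V)
    (hres : ∀ k, k ≤ P.K → HRestrict F N εbg P.K k (domAltOfRecord F N θ₀.ν P.K k))
    (huniq : ∀ k, k ≤ P.K → ∀ V ∈ domAltOfRecord F N θ₀.ν P.K k, ∀ j < k,
      UniqueUkOrbit F N P.K (j + 1) εbg (Averaging.iter (avOfRecord F N P.K) (j + 1) (Uk F N P.K k εbg V)))
    (hreg8 : ∀ k, k ≤ P.K → ∀ V ∈ domAltOfRecord F N θ₀.ν P.K k, Uk F N P.K k εbg V ∈ bgReg F N P.K k θ₀.ν.εreg) (hle : θ₀.ν.εreg ≤ εbg) (hεreg : 0 ≤ θ₀.ν.εreg)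
    (haxbg : ∀ k, k ≤ P.K → ∀ V ∈ domAltOfRecord F N θ₀.ν P.K k, ∀ j < k,
      AxialGauge (contourOfRecord F N P.K j) (Averaging.iter (avOfRecord F N P.K) j (Uk F N P.K k εbg V)))
    (hε : 0 < εbg) (hε3 : (143 * (((((F.P P.K).d + 4 : ℕ) : ℝ)) ^ 2 / 4) ^ 2) * εbg ≤ 1 / 3)
    (hε2 : 2 * εbg ≤ 2 * deltaSU (Fin N) / ((((F.P P.K).d + 4) * (F.P P.K).L : ℕ) : ℝ) ^ 2) (hε₀ : 2 * εbg ≤ θ₀.ν.ε₀ * ((F.P P.K).L : ℝ) ^ 2) :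
    ∀ k, k ≤ P.K → ∀ V ∈ domAltOfRecord F N θ₀.ν P.K k, ∀ i, i + 1 < k →
      Averaging.iter (avOfRecord F N P.K) (i + 1) (Uk F N P.K k εbg V) ∈
        regSetOfRecord F N P.K i (betaInputOfRecord F N (TβOfRecord₁₃ F N) (chiβOfRecord₁₃Ax F N θ₀) P.K (gOfRecord₁₃Ax F N θ₀ P) i) ∩
          domAltOfRecord F N θ₀.ν P.K (i + 1) := by
  intro k hk V hV i hi
  have hone := chiβ13Ax_iterUk_eq_one_of_critCfgAx_hered θ₀ hεχ P
    (heredAx_of_hierAxial_of_thm1_εbg_of_reg8 θ₀.ν εbg P.K hres huniq hreg8 hle hεreg haxbg) k hk V hV (i + 1) hi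
  -- the next average is a small field
  have hnext : (avOfRecord F N P.K (i + 1)).avg (Averaging.iter (avOfRecord F N P.K) (i + 1) (Uk F N P.K k εbg V)) ∈
      domAltOfRecord F N θ₀.ν P.K (i + 2) := by
    show Averaging.iter (avOfRecord F N P.K) (i + 2) (Uk F N P.K k εbg V) ∈ domAltOfRecord F N θ₀.ν P.K (i + 2)
    rcases Nat.lt_or_ge (i + 2) k with h | h
    · exact iterUk_mem_domAlt_of_ukExists θ₀.ν hε hε3 hε2 hε₀ (hex k hk V hV) h
    · obtain rfl : k = i + 2 := le_antisymm h (by omega)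
      rw [iter_Uk (hex (i + 2) hk V hV)]
      exact hV
  by_contra hn
  exact one_ne_zero (hone ▸ hχregpt i (lt_of_lt_of_le hi hk) _ hnext hn)

/-! ## §4. ★★★ THE Ax DOOR v2 — N09's Theorem-3 member at the re-centred record from its located rows, NO covariance ∕ critical-configuration axiality row -/

/-- ★★★ **N24's `h09T` AT A WORLD BOUND TO THE RE-CENTRED STAGE-13 RECORD, ON THE SMALL-FIELD DOMAINS — Ax door v2**: ✓p811884's door v1 (`…_of_thm1reg`) with its nesting row fed by §3
and its [B11]-at-`εreg` row by dag-n09-w1's `thm1Package_εreg_of_εbg_of_reg8` (FILE 2).  Displayed: `hreg8` ((8)-membership of the level-`k` background), `hle`, `hεreg`, `haxbg` (the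
background's partial averages are block-axial for the record's contour data `contourOfRecord F N P.K j`), the POINTWISE (F7a) clause `hχregpt`, (I19) `hint`, [B11] Thm 1 ×3 at `θ.εbg`
(`h11 ∕ hres ∕ huniq`), `0 < θ.ε₂₉`, `0 < θ.εbg`, `143·((d+4)²∕4)²·θ.εbg ≤ ⅓`, `2θ.εbg ≤ 2δ_N∕((d+4)L)²`, `2θ.εbg ≤ θ.ν.ε₀·L²` — the centred door v1.2's list WITHOUT `haxDom` and WITHOUT
contour data for the critical configuration.  CONDITIONAL on every displayed hypothesis; nothing of Bałaban asserted; N09 NOT discharged; K1ᴬ NOT closed.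
[cite: Balaban1987RG1, Thm 3 p.264, (1.1)–(1.3) p.260, (2.1)–(2.3) p.265, (2.9)–(2.10) pp.266–267, (2.16) p.269; Balaban1985Variational, Thm 1 (6), (8)–(10) p.279 and (181) p.307; Balaban1985Averaging, Prop. 2 (53) p.26] -/
theorem thm3Member_forall_stage13SepCoPHAx_onDomains_of_hierAxial_of_reg8_of_suppPt (θ : Stage13HParams F N) (h : θ.Provisos₁₃SepCoPHAx F N) {w : WorldP}
    (hC : w.C = (datumOfRecord₁₃SepCoPHAx F N θ h).C)
    (hreg8 : ∀ (P : B12.RunParams) (k : ℕ), k ≤ P.K → ∀ V ∈ domAltOfRecord F N θ.ν P.K k, Uk F N P.K k θ.εbg V ∈ bgReg F N P.K k θ.ν.εreg)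
    (hle : θ.ν.εreg ≤ θ.εbg) (hεreg : 0 ≤ θ.ν.εreg)
    (haxbg : ∀ (P : B12.RunParams) (k : ℕ), k ≤ P.K → ∀ V ∈ domAltOfRecord F N θ.ν P.K k, ∀ j < k,
      AxialGauge (contourOfRecord F N P.K j) (Averaging.iter (avOfRecord F N P.K) j (Uk F N P.K k θ.εbg V)))
    (hχregpt : ∀ (P : B12.RunParams) (i : ℕ), i + 1 < P.K → ∀ U : GaugeField (F.P P.K) (i + 1) (SU N),
      (avOfRecord F N P.K (i + 1)).avg U ∈ domAltOfRecord F N θ.ν P.K (i + 2) →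
        U ∉ regSetOfRecord F N P.K i (betaInputOfRecord F N (TβOfRecord₁₃ F N) (chiβOfRecord₁₃Ax F N θ.toStage13Params) P.K (gOfRecord₁₃Ax F N θ.toStage13Params P) i) ∩
            domAltOfRecord F N θ.ν P.K (i + 1) →
          chiβOfRecord₁₃Ax F N θ.toStage13Params P.K (gOfRecord₁₃Ax F N θ.toStage13Params P) (i + 1) U = 0)
    (hint : ∀ (P : B12.RunParams), ∀ j < P.K, Integrable (betaInputOfRecord F N (TβOfRecord₁₃ F N) (chiβOfRecord₁₃Ax F N θ.toStage13Params) P.K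
      (gOfRecord₁₃Ax F N θ.toStage13Params P) j) (fieldMeasure (F.P P.K) j (SU N)))
    (h11 : ∀ (P : B12.RunParams) (k : ℕ), k ≤ P.K → ∀ V ∈ domAltOfRecord F N θ.ν P.K k, UkExists F N P.K k θ.εbg V ∧ UniqueUkOrbit F N P.K k θ.εbg V)
    (hres : ∀ (P : B12.RunParams) (k : ℕ), k ≤ P.K → HRestrict F N θ.εbg P.K k (domAltOfRecord F N θ.ν P.K k))
    (huniq : ∀ (P : B12.RunParams) (k : ℕ), k ≤ P.K → ∀ V ∈ domAltOfRecord F N θ.ν P.K k, ∀ j < k,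
      UniqueUkOrbit F N P.K (j + 1) θ.εbg (Averaging.iter (avOfRecord F N P.K) (j + 1) (Uk F N P.K k θ.εbg V)))
    (hεχ : 0 < θ.ε₂₉) (hε : 0 < θ.εbg)
    (hε3 : ∀ P : B12.RunParams, (143 * (((((F.P P.K).d + 4 : ℕ) : ℝ)) ^ 2 / 4) ^ 2) * θ.εbg ≤ 1 / 3)
    (hε2 : ∀ P : B12.RunParams, 2 * θ.εbg ≤ 2 * deltaSU (Fin N) / ((((F.P P.K).d + 4) * (F.P P.K).L : ℕ) : ℝ) ^ 2)
    (hε₀ : ∀ P : B12.RunParams, 2 * θ.εbg ≤ θ.ν.ε₀ * ((F.P P.K).L : ℝ) ^ 2) :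
    ∀ P : B12.RunParams, (leavesP w P).smallCouplings → (leavesP w P).smallFieldInductive :=
  thm3Member_forall_stage13SepCoPHAx_onDomains_of_thm1reg θ h hC (fun P => hχregAx_ae_of_suppPt θ.toStage13Params P (hχregpt P)) hint h11
    (fun P j hj W hW => (thm1Package_εreg_of_εbg_of_reg8 θ.ν θ.εbg P.K (h11 P) (hres P) (huniq P) (hreg8 P) hle hεreg).1 (j + 1) hj W hW)
    hres huniq
    (fun P => hnestregAx_of_suppPt_of_hierAxial_of_reg8 θ.toStage13Params hεχ P (hχregpt P) (fun k hk V hV => (h11 P k hk V hV).1) (hres P) (huniq P) (hreg8 P)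
      hle hεreg (haxbg P) hε (hε3 P) (hε2 P) (hε₀ P))

/-! ## §5. The Ax engine's `h09T` member shape from the same rows -/

/-- **THE Ax ENGINE ✓p811182's `h09T` SHAPE AT ANY `(θ, h)` FROM §4's ROWS** (`γ₉ := 1`; the conclusion does not read `w.γ`).  CONDITIONAL; N09 NOT discharged.
[cite: Balaban1987RG1, Thm 3 p.264, (2.1)–(2.3) p.265, (2.9)–(2.10) pp.266–267; Balaban1985Variational, Thm 1 (6), (8)–(10) p.279; Balaban1985Averaging, Prop. 2 (53) p.26] -/
theorem h09T_recordAx_of_hierAxial_of_reg8_of_suppPt (θ : Stage13HParams F N) (h : θ.Provisos₁₃SepCoPHAx F N)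
    (hreg8 : ∀ (P : B12.RunParams) (k : ℕ), k ≤ P.K → ∀ V ∈ domAltOfRecord F N θ.ν P.K k, Uk F N P.K k θ.εbg V ∈ bgReg F N P.K k θ.ν.εreg)
    (hle : θ.ν.εreg ≤ θ.εbg) (hεreg : 0 ≤ θ.ν.εreg)
    (haxbg : ∀ (P : B12.RunParams) (k : ℕ), k ≤ P.K → ∀ V ∈ domAltOfRecord F N θ.ν P.K k, ∀ j < k,
      AxialGauge (contourOfRecord F N P.K j) (Averaging.iter (avOfRecord F N P.K) j (Uk F N P.K k θ.εbg V)))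
    (hχregpt : ∀ (P : B12.RunParams) (i : ℕ), i + 1 < P.K → ∀ U : GaugeField (F.P P.K) (i + 1) (SU N),
      (avOfRecord F N P.K (i + 1)).avg U ∈ domAltOfRecord F N θ.ν P.K (i + 2) →
        U ∉ regSetOfRecord F N P.K i (betaInputOfRecord F N (TβOfRecord₁₃ F N) (chiβOfRecord₁₃Ax F N θ.toStage13Params) P.K (gOfRecord₁₃Ax F N θ.toStage13Params P) i) ∩
            domAltOfRecord F N θ.ν P.K (i + 1) →
          chiβOfRecord₁₃Ax F N θ.toStage13Params P.K (gOfRecord₁₃Ax F N θ.toStage13Params P) (i + 1) U = 0)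
    (hint : ∀ (P : B12.RunParams), ∀ j < P.K, Integrable (betaInputOfRecord F N (TβOfRecord₁₃ F N) (chiβOfRecord₁₃Ax F N θ.toStage13Params) P.K
      (gOfRecord₁₃Ax F N θ.toStage13Params P) j) (fieldMeasure (F.P P.K) j (SU N)))
    (h11 : ∀ (P : B12.RunParams) (k : ℕ), k ≤ P.K → ∀ V ∈ domAltOfRecord F N θ.ν P.K k, UkExists F N P.K k θ.εbg V ∧ UniqueUkOrbit F N P.K k θ.εbg V)
    (hres : ∀ (P : B12.RunParams) (k : ℕ), k ≤ P.K → HRestrict F N θ.εbg P.K k (domAltOfRecord F N θ.ν P.K k))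
    (huniq : ∀ (P : B12.RunParams) (k : ℕ), k ≤ P.K → ∀ V ∈ domAltOfRecord F N θ.ν P.K k, ∀ j < k,
      UniqueUkOrbit F N P.K (j + 1) θ.εbg (Averaging.iter (avOfRecord F N P.K) (j + 1) (Uk F N P.K k θ.εbg V)))
    (hεχ : 0 < θ.ε₂₉) (hε : 0 < θ.εbg)
    (hε3 : ∀ P : B12.RunParams, (143 * (((((F.P P.K).d + 4 : ℕ) : ℝ)) ^ 2 / 4) ^ 2) * θ.εbg ≤ 1 / 3)
    (hε2 : ∀ P : B12.RunParams, 2 * θ.εbg ≤ 2 * deltaSU (Fin N) / ((((F.P P.K).d + 4) * (F.P P.K).L : ℕ) : ℝ) ^ 2)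
    (hε₀ : ∀ P : B12.RunParams, 2 * θ.εbg ≤ θ.ν.ε₀ * ((F.P P.K).L : ℝ) ^ 2) :
    ∃ γ₉ : ℝ, 0 < γ₉ ∧ ∀ w : WorldP, w.C = (datumOfRecord₁₃SepCoPHAx F N θ h).C → w.γ ≤ γ₉ →
      ∀ P : B12.RunParams, (leavesP w P).smallCouplings → (leavesP w P).smallFieldInductive :=
  ⟨1, one_pos, fun _ hC _ => thm3Member_forall_stage13SepCoPHAx_onDomains_of_hierAxial_of_reg8_of_suppPt θ h hC hreg8 hle hεreg haxbg hχregpt hint h11 hres huniq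
    hεχ hε hε3 hε2 hε₀⟩

end Summit.QuantumFields.YangMills.BalabanUVNodes.N09NestingOfHierAxialAtRecordAx

end
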